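import Literature.NumberTheory.Rogawski1990.SmoothTransferSplitPlaceNamed               -- ★ `isLocalDeltaTransfer_cmSplitTransfer` (L. 4.13.1 (a) by name); brings ★ `UnitaryGroup.cmSplitTransfer`, ★ `HeckeCharacter.galConj_eq_inv_of_restrict_eq_quadraticHeckeCharCM`
import Literature.NumberTheory.Automorphic.LocalUnitaryIntegralLevel                    -- ★ `UnitaryGroup.antidiagOne_map_transpose`, `isUnit_placeForm_antidiagOne`
import Literature.NumberTheory.Rogawski1990.LocalTransferFundamentalLemma                 -- ★ `IsLocSmooth`
import Literature.NumberTheory.Automorphic.SmoothCharacter                               -- ★ `IrrClass.smoothTrace`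
import HarnessLib

/-!
# R90 · S3 — (R-ii) the endoscopic character identity AT A SPLIT PLACE, composed over «packet traces are stable» and «van Dijk for the named split transfer»

R90-TF section S3 (dealer R90-C12-plan (g0)), hand p06 «A1-split», payer file (R-ii) of RULING S3-R5″ (2026-09-04T16:18:56Z ∕ 16:22:31Z «TYPE NOW the hypothesis-first
composition»): the split-place twin `stub_R90_S3_endoExpansion_exists_split` of socket A1 (`Lines/R90_S3_EndoCharIdentityA`, A ED. 2: A1's bytes with the non-split
guard `hv` swapped for `hs : ∃ w, c • w.1 ≠ w.1`) asks, at a place `v` of `L⁺` SPLIT in `L`, for a finitely supported `ℤ`-expansion `c` with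
`Σ_{σ∈ρ} Tr σ(f^H) = Σ_π c(π) Tr π(f)` for EVERY `Δ‴_v`-matched smooth pair `(f^H, f)` (file C's `IsEndoExpansion`).  Print: at a split `v`, `G_v ≅ GL₃(E_w)`,
`H_v ≅ GL₂(E_w) × GL₁(E_w) = M` is a Levi subgroup, `f ↦ f̄^P` is a `Δ_{G/H}`-transfer and `χ_{i_G(ξ)}(f) = ξ(f̄^P)` [§4.13 Lemma 4.13.1 (a)(b) p. 64]; «if `v` splits
in `E` … (∗) holds» [§13.8 p. 217].  THE COMPOSITION (`endoExpansion_exists_split_of_stable_of_vanDijk`), in A1's binder frame with `hv ↦ hs`: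

* (S) `hS : IsStableFinsetH L v νH mH ρ` — «the packet trace `f^H ↦ Σ_{σ∈ρ} Tr σ(f^H)` is determined by the stable (= ordinary, at a split place) `G`-regular
  orbital integrals of `f^H`» — S4-B's socket `stub_R90_S4_H_stable` READ AT THE SPLIT PLACE (that socket carries no place guard), BY SHAPE; in print: characters are
  locally integrable functions (Harish-Chandra) + Weyl integration on `H_v`.
* (VD) `hVD` — «van Dijk for the NAMED split transfer, summed over the packet»: for the explicit `Δ‴_v`-transfer `f ↦ τ_v · f̄^P` (★ `UnitaryGroup.cmSplitTransfer`,
  which IS a smooth `Δ‴_v`-transfer for canonical families by ★ `isLocalDeltaTransfer_cmSplitTransfer`), there is a finitely supported `c : Irr(G′_v) →₀ ℤ` with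
  `Σ_{σ∈ρ} Tr σ(τ_v · f̄^P) = Σ_π c(π) Tr π(f)` for all test functions `f` — print's Lemma 4.13.1 (b) for the (vector-valued) `(2,1)`-parabolic induction of
  `σ ⊠ χ₁` to `GL₃(E_w)` plus Jordan–Hölder additivity of the trace (`c` = the JH multiplicities of `Ind(ρ̃)`); typed ON THE CM CARRIERS for the named transfer
  (the GL-currency statement and the dictionary `U(H′)_v ≃ GL₃(E_w)` discharge it later — FILE E print socket per S3-R4).
* ⟹ `∃ c, IsEndoExpansion L H′ v νG νH Δ‴_v mH mG ρ c` — A1's conclusion token for token: for a matched smooth pair `(f^H, f)`, both `f^H` and `τ_v · f̄^P` are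
  `Δ‴_v`-transfers of `f`, so they have the same `G`-regular stable orbital integrals (`= Σᶠ_c Δ‴_v(γ_H, c) Φ(c, f)`), hence (S) the same packet trace, which (VD) expands.

The transfer-existence hypothesis `hT` and the packet key `IsRogPacketH ρ` of the socket are NOT needed by the composition (it holds for every finset `ρ` given (S), (VD));
the socket's payment term at A ED. 3 simply ignores them.  File C's `IsStableFinsetH` (in `hS`) and `IsEndoExpansion` (conclusion) are written UNFOLDED, token for token,
so that this file imports ★ Literature only (Theorems may not import `Lines`); both fold back by `Iff.rfl` at the junction.  HONEST LABEL: a composition — nothing printed in Ch. 13 is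
proved here; (S) is a floor input (HC harmonic analysis on `H_v`), (VD) a printed lemma [L. 4.13.1 (b)] not yet in tree for vector-valued inducing data; HC_CM is proved only
modulo the 7 printed citations (2 remaining named inputs: hLiu418 = stmt-HodgeConjecture-24832, h413 = stmt-HodgeConjecture-24833) until rung 0 closes; REL ≠ ★ ≠ BUILT.
-/

set_option autoImplicit false
set_option linter.dupNamespace false

noncomputable section

namespace Summit.HodgeConjecture.HodgeConjecture.R90.S3

open MeasureTheory IsDedekindDomain NumberField
open Literature.NumberTheory Literature.NumberTheory.Automorphic Literature.NumberTheory.Automorphic.UnitaryGroup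
open Literature.NumberTheory.Rogawski1990 Literature.NumberTheory.GaloisRepresentations
open scoped Matrix

variable (L : Type) [Field L] [NumberField L] [IsCMField L] (H' : Matrix (Fin 3) (Fin 3) L)
  (v : HeightOneSpectrum (𝓞 ↥(maximalRealSubfield L)))

/-- **(R-ii) — THE ENDOSCOPIC EXPANSION AT A SPLIT PLACE, composed over (S) «packet traces are stable» and (VD) «van Dijk for the named split transfer»**
[Thm. 13.1.1 (2) at a place split in `E`: §13.8 p. 217 «if `v` splits in `E` … (∗) holds»; §4.13 Lemma 4.13.1 (a)(b) p. 64]: in socket A1's frame with the non-split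
guard replaced by `hs` (two places above `v`), for `H′` hermitian with `det H′` a unit, the unitary Hecke character `μ` restricting to `ω_{E/F}` (`hμω` ⇒ `μ^c = μ⁻¹`,
★ `HeckeCharacter.galConj_eq_inv_of_restrict_eq_quadraticHeckeCharCM`), right Haar measures `νG`, `νH`, CANONICAL orbital families `(mH, mG)` (`hm`), the factors of
record `Δ‴_v` (★ `finExplicitCollection`) and ANY finset `ρ` of classes of `H_v`:  (S) `IsStableFinsetH L v νH mH ρ` and (VD) «for every place `w ∣ v` with `c • w ≠ w`
there is a finitely supported `c : Irr(G′_v) →₀ ℤ` with `Σ_{σ∈ρ} Tr σ(cmSplitTransfer … f) = Σ_π c(π) Tr π(f)` for all `f ∈ C_c^∞(G′_v)`» give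
`∃ c, IsEndoExpansion L H′ v νG νH Δ‴_v mH mG ρ c`.  Proof: both `f^H` and the named transfer `τ_v · f̄^P` (★ `isLocalDeltaTransfer_cmSplitTransfer`, Lemma 4.13.1 (a))
are `Δ‴_v`-transfers of `f`, so their `G`-regular stable orbital integrals agree; (S) equates the packet traces; (VD) expands the second.
[cite: Rogawski1990, §13.1 Thm. 13.1.1 (2) p. 198; §13.8 p. 217; §4.13 Lemma 4.13.1 pp. 64–66; §4.3 (4.3.1) p. 43; §4.9 p. 55] -/
theorem endoExpansion_exists_split_of_stable_of_vanDijk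
    (hH' : (H'.map (cmConjRingHom L))ᵀ = H') (hH'd : IsUnit H'.det)
    (μ : HeckeCharacter L)
    (hμω : ∀ x : Literature.NumberTheory.GaloisRepresentations.ideleGroup ↥(maximalRealSubfield L),
      μ (AdeleRing.ideleBaseChange (↥(maximalRealSubfield L)) L x) = quadraticHeckeCharCM L x)
    (hs : ∃ w : UnitaryGroup.PlacesOver L v, IsCMField.complexConj L • w.1 ≠ w.1)
    [MeasurableSpace ((UnitaryGroup.cmDatum L 3 H').Local v)] [BorelSpace ((UnitaryGroup.cmDatum L 3 H').Local v)]
    [MeasurableSpace ((UnitaryGroup.cmDatum L 2 (Matrix.of fun i j : Fin 2 => if i.val + j.val + 1 = 2 then (1 : L) else 0)).Local v ×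
      (UnitaryGroup.cmDatum L 1 (Matrix.of fun i j : Fin 1 => if i.val + j.val + 1 = 1 then (1 : L) else 0)).Local v)]
    [BorelSpace ((UnitaryGroup.cmDatum L 2 (Matrix.of fun i j : Fin 2 => if i.val + j.val + 1 = 2 then (1 : L) else 0)).Local v ×
      (UnitaryGroup.cmDatum L 1 (Matrix.of fun i j : Fin 1 => if i.val + j.val + 1 = 1 then (1 : L) else 0)).Local v)]
    [∀ a : ((UnitaryGroup.cmDatum L 2 (Matrix.of fun i j : Fin 2 => if i.val + j.val + 1 = 2 then (1 : L) else 0)).Local v ×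
      (UnitaryGroup.cmDatum L 1 (Matrix.of fun i j : Fin 1 => if i.val + j.val + 1 = 1 then (1 : L) else 0)).Local v),
      MeasurableSpace (((UnitaryGroup.cmDatum L 2 (Matrix.of fun i j : Fin 2 => if i.val + j.val + 1 = 2 then (1 : L) else 0)).Local v ×
      (UnitaryGroup.cmDatum L 1 (Matrix.of fun i j : Fin 1 => if i.val + j.val + 1 = 1 then (1 : L) else 0)).Local v) ⧸
        Subgroup.centralizer ({a} : Set ((UnitaryGroup.cmDatum L 2 (Matrix.of fun i j : Fin 2 => if i.val + j.val + 1 = 2 then (1 : L) else 0)).Local v ×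
      (UnitaryGroup.cmDatum L 1 (Matrix.of fun i j : Fin 1 => if i.val + j.val + 1 = 1 then (1 : L) else 0)).Local v)))]
    [∀ a : ((UnitaryGroup.cmDatum L 2 (Matrix.of fun i j : Fin 2 => if i.val + j.val + 1 = 2 then (1 : L) else 0)).Local v ×
      (UnitaryGroup.cmDatum L 1 (Matrix.of fun i j : Fin 1 => if i.val + j.val + 1 = 1 then (1 : L) else 0)).Local v),
      BorelSpace (((UnitaryGroup.cmDatum L 2 (Matrix.of fun i j : Fin 2 => if i.val + j.val + 1 = 2 then (1 : L) else 0)).Local v ×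
      (UnitaryGroup.cmDatum L 1 (Matrix.of fun i j : Fin 1 => if i.val + j.val + 1 = 1 then (1 : L) else 0)).Local v) ⧸
        Subgroup.centralizer ({a} : Set ((UnitaryGroup.cmDatum L 2 (Matrix.of fun i j : Fin 2 => if i.val + j.val + 1 = 2 then (1 : L) else 0)).Local v ×
      (UnitaryGroup.cmDatum L 1 (Matrix.of fun i j : Fin 1 => if i.val + j.val + 1 = 1 then (1 : L) else 0)).Local v)))]
    [∀ γ : ((UnitaryGroup.cmDatum L 3 H').Local v), MeasurableSpace (((UnitaryGroup.cmDatum L 3 H').Local v) ⧸ Subgroup.centralizer ({γ} : Set ((UnitaryGroup.cmDatum L 3 H').Local v)))]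
    [∀ γ : ((UnitaryGroup.cmDatum L 3 H').Local v), BorelSpace (((UnitaryGroup.cmDatum L 3 H').Local v) ⧸ Subgroup.centralizer ({γ} : Set ((UnitaryGroup.cmDatum L 3 H').Local v)))]
    (νG : Measure ((UnitaryGroup.cmDatum L 3 H').Local v)) [νG.IsHaarMeasure] [νG.IsMulRightInvariant]
    (νH : Measure ((UnitaryGroup.cmDatum L 2 (Matrix.of fun i j : Fin 2 => if i.val + j.val + 1 = 2 then (1 : L) else 0)).Local v ×
      (UnitaryGroup.cmDatum L 1 (Matrix.of fun i j : Fin 1 => if i.val + j.val + 1 = 1 then (1 : L) else 0)).Local v))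
    [νH.IsHaarMeasure] [νH.IsMulRightInvariant]
    (mH : OrbitalMeasureFamily ((UnitaryGroup.cmDatum L 2 (Matrix.of fun i j : Fin 2 => if i.val + j.val + 1 = 2 then (1 : L) else 0)).Local v ×
      (UnitaryGroup.cmDatum L 1 (Matrix.of fun i j : Fin 1 => if i.val + j.val + 1 = 1 then (1 : L) else 0)).Local v))
    (mG : OrbitalMeasureFamily ((UnitaryGroup.cmDatum L 3 H').Local v))
    (hm : mH.IsCanonical (IsLocalGRegular L v) νH ∧
      mG.IsCanonical (fun γ => IsRegularElt (γ.val : GL (Fin 3) (UnitaryGroup.LocalRing L v))) νG)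
    (ρ : Finset (IrrClass ((UnitaryGroup.cmDatum L 2 (Matrix.of fun i j : Fin 2 => if i.val + j.val + 1 = 2 then (1 : L) else 0)).Local v ×
      (UnitaryGroup.cmDatum L 1 (Matrix.of fun i j : Fin 1 => if i.val + j.val + 1 = 1 then (1 : L) else 0)).Local v)))
    (hS : ∀ fH fH' : ((UnitaryGroup.cmDatum L 2 (Matrix.of fun i j : Fin 2 => if i.val + j.val + 1 = 2 then (1 : L) else 0)).Local v ×
        (UnitaryGroup.cmDatum L 1 (Matrix.of fun i j : Fin 1 => if i.val + j.val + 1 = 1 then (1 : L) else 0)).Local v) → ℂ,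
      IsLocSmooth fH → IsLocSmooth fH' →
        (∀ γH, IsLocalGRegular L v γH →
          stableOrbitalIntegralRel (IsLocalStablyConjH L v) mH fH γH = stableOrbitalIntegralRel (IsLocalStablyConjH L v) mH fH' γH) →
        ∑ σ ∈ ρ, σ.smoothTrace νH fH = ∑ σ ∈ ρ, σ.smoothTrace νH fH')
    (hVD : ∀ (w : UnitaryGroup.PlacesOver L v) (hw : IsCMField.complexConj L • w.1 ≠ w.1),
      ∃ c : IrrClass ((UnitaryGroup.cmDatum L 3 H').Local v) →₀ ℤ,
        ∀ f : (UnitaryGroup.cmDatum L 3 H').Local v → ℂ, IsLocSmooth f →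
          ∑ σ ∈ ρ, σ.smoothTrace νH (UnitaryGroup.cmSplitTransfer L H' hH' hH'd v w hw μ νH νG f) =
            ∑ π ∈ c.support, (c π : ℂ) * π.smoothTrace νG f) :
    ∃ c : IrrClass ((UnitaryGroup.cmDatum L 3 H').Local v) →₀ ℤ,
      ∀ (fH : (UnitaryGroup.cmDatum L 2 (Matrix.of fun i j : Fin 2 => if i.val + j.val + 1 = 2 then (1 : L) else 0)).Local v ×
        (UnitaryGroup.cmDatum L 1 (Matrix.of fun i j : Fin 1 => if i.val + j.val + 1 = 1 then (1 : L) else 0)).Local v → ℂ)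
        (f : (UnitaryGroup.cmDatum L 3 H').Local v → ℂ),
        IsLocSmooth fH → IsLocSmooth f →
          IsLocalDeltaTransfer L H' v
            (finExplicitCollection L H' μ (finExplicitDelta_conj_left_all L H' μ) (finExplicitDelta_conj_right_all L H' μ) v) mH mG fH f →
          ∑ σ ∈ ρ, σ.smoothTrace νH fH = ∑ π ∈ c.support, (c π : ℂ) * π.smoothTrace νG f := by
  classical
  obtain ⟨w, hw⟩ := hs
  obtain ⟨c, hc⟩ := hVD w hw
  refine ⟨c, fun fH f hfH hf ht => ?_⟩
  -- the frame data of ★ `isLocalDeltaTransfer_cmSplitTransfer` (as in ★ `isLocalDeltaTransferExists_finExplicit_of_split_of_isCanonical`)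
  letI : MeasurableSpace (w.1.adicCompletion L) := borel _
  haveI : BorelSpace (w.1.adicCompletion L) := ⟨rfl⟩
  have hΦ₂d : (Matrix.of fun i j : Fin 2 => if i.val + j.val + 1 = 2 then (1 : L) else 0).det ≠ 0 := by
    have h : (Matrix.of fun i j : Fin 2 => if i.val + j.val + 1 = 2 then (1 : L) else 0) = !![0, 1; 1, 0] := by
      ext i j; fin_cases i <;> fin_cases j <;> rfl
    rw [h, Matrix.det_fin_two_of]; norm_num
  have hΦ₁d : (Matrix.of fun i j : Fin 1 => if i.val + j.val + 1 = 1 then (1 : L) else 0).det ≠ 0 := by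
    rw [Matrix.det_fin_one, Matrix.of_apply]; norm_num
  have hΦ₂' : ((Matrix.of fun i j : Fin 2 => if i.val + j.val + 1 = 2 then (1 : L) else 0).map (cmConjRingHom L))ᵀ =
      Matrix.of fun i j : Fin 2 => if i.val + j.val + 1 = 2 then (1 : L) else 0 := by
    rw [UnitaryGroup.map_cmConjRingHom_eq_map_complexConj]; exact UnitaryGroup.antidiagOne_map_transpose (IsCMField.complexConj L) 2
  have hΦ₁' : ((Matrix.of fun i j : Fin 1 => if i.val + j.val + 1 = 1 then (1 : L) else 0).map (cmConjRingHom L))ᵀ =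
      Matrix.of fun i j : Fin 1 => if i.val + j.val + 1 = 1 then (1 : L) else 0 := by
    rw [UnitaryGroup.map_cmConjRingHom_eq_map_complexConj]; exact UnitaryGroup.antidiagOne_map_transpose (IsCMField.complexConj L) 1
  have hH'c : (H'.map (IsCMField.complexConj L))ᵀ = H' := (UnitaryGroup.map_cmConjRingHom_eq_map_complexConj L H') ▸ hH'
  -- Lemma 4.13.1 (a) BY NAME: the named split transfer is a smooth `Δ‴_v`-transfer of `f`
  obtain ⟨hsm, htr⟩ := isLocalDeltaTransfer_cmSplitTransfer L H' (IsCMField.complexConj_ne_one L) w hw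
    (UnitaryGroup.antidiagOne_map_transpose (IsCMField.complexConj L) 2) (UnitaryGroup.isUnit_placeForm_antidiagOne (E := L) 2 w.1)
    (UnitaryGroup.antidiagOne_map_transpose (IsCMField.complexConj L) 1) (UnitaryGroup.isUnit_placeForm_antidiagOne (E := L) 1 w.1)
    hH'c (UnitaryGroup.isUnit_placeForm_of_isUnit_det hH'd w.1) hΦ₂' hΦ₂d hΦ₁' hΦ₁d μ
    (finExplicitDelta_conj_left_all L H' μ) (finExplicitDelta_conj_right_all L H' μ)
    (HeckeCharacter.galConj_eq_inv_of_restrict_eq_quadraticHeckeCharCM L μ hμω) νH νG mH mG hm.1 hm.2 hH' hH'd f hf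
  -- two transfers of the same `f` have the same `G`-regular stable orbital integrals
  have heq : ∀ γH, IsLocalGRegular L v γH →
      stableOrbitalIntegralRel (IsLocalStablyConjH L v) mH fH γH =
        stableOrbitalIntegralRel (IsLocalStablyConjH L v) mH (UnitaryGroup.cmSplitTransfer L H' hH' hH'd v w hw μ νH νG f) γH :=
    fun γH hreg => (ht γH hreg).trans (htr γH hreg).symm
  rw [hS fH _ hfH hsm heq]
  exact hc f hf

end Summit.HodgeConjecture.HodgeConjecture.R90.S3

end
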